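import Literature.Probability.LatticeModels.PercolationRowTransfer
import HarnessLib

/-!
# Single-edge operators for the percolation row transfer matrix (detach / join)

Companion to `PercolationRowTransfer.lean` (the stochastic row-to-row transfer matrix `T_S` of bond
percolation on `ℤ²` at `p = 1/2`, definition request `PercolationRowTransfer` of route
`CriticalPhenomena/CardyPolygonWords`). That file builds one row step from two LAYERS
(`vertRel O`: the vertical edges below the sites of `O` open; `horizRel H`: the horizontal edges
labelled by `H` open). Here the layers are factorised EDGE BY EDGE, the form in which transfer
matrices of percolation are written and used in proofs and computations (Jacobsen–Zinn-Justin,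
*A transfer matrix for the backbone exponent of two-dimensional percolation*, J. Phys. A 35 (2002)
2131, arXiv:cond-mat/0111374, §4: "critical bond percolation on a square lattice […] since
`p_c = 1/2` it is convenient to simply assign a weight of one to every configuration of
percolating/non-percolating bonds"; "a factorization of the transfer matrix […]
`T(L) = H₁⋯H_L V₁⋯V_L` where `Vᵢ` (resp. `Hᵢ`) corresponds to the addition of a single vertical
(resp. horizontal) bond"; "`Vᵢ = V'ᵢ + V''ᵢ` […] `V'ᵢ` is simply the identity").

* `detachRel x = vertRel (univ.erase x)` — ONE closed vertical bond (the site `x` becomes a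
  singleton: the "detach" generator `D_x`), with `detachRel_apply`; the vertical layer is the
  composite of the detach generators of its closed bonds: `vertRel_univ`, `vertRel_vertRel`,
  `vertRel_erase : vertRel (O.erase x) = detachRel x ∘ vertRel O`.
* `joinRel x π = π ⊔ hEdgeRel x` — ONE open horizontal bond (merge the classes of `x` and
  `x + 1`: the "join" generator `J_x`), with the pointwise description `joinRel_apply` (through
  `sup_joinTwo_apply`: after merging the classes of `u` and `v`, two points are joined iff they
  were, or each was joined to `u` or to `v`); the horizontal layer is the composite of the join
  generators of its open bonds: `horizRel_empty`, `horizRel_union`, `horizRel_insert`.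
* `D_x² = D_x`, `J_x² = J_x`, and the generators of each kind commute
  (`detachRel_detachRel`, `joinRel_joinRel`, `detachRel_comm`, `joinRel_comm`).
* On connectivity states: `RowState.detach`, `RowState.join`, and the peeling lemmas
  `rowStep_eq_horiz_vert`, `rowStep_erase_empty : rowStep (O.erase x) ∅ = D_x ∘ rowStep O ∅`,
  `rowStep_insert : rowStep O (insert x H) = J_x ∘ rowStep O H`, `rowStep_univ_empty`.

The mixed Temperley–Lieb relations (`J D J = J`, `D J D = D`, far commutation) are in
`PercolationRowTransferTL.lean`; the product formula `T_S = ∏ (1 + D_x)/2 ∏ (1 + J_e)/2` in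
`PercolationRowTransferProduct.lean`.
-/

noncomputable section

open Finset Matrix
open scoped BigOperators Classical

namespace Literature.Probability.LatticeModels

variable {S : Finset ℤ}

/-! ### Vertical layer: all-open, composition, single closed edge -/

/-- Every row point is open towards the new row when all vertical edges are open. [folklore] -/
theorem isUp_univ (a : RowPoint S) : IsUp (univ : Finset S) a := by
  cases a with
  | inl x => exact mem_univ x
  | inr u => trivial

/-- Openness for an intersection of vertical configurations. [folklore] -/
theorem isUp_inter (O O' : Finset S) (a : RowPoint S) : IsUp (O ∩ O') a ↔ IsUp O a ∧ IsUp O' a := by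
  cases a with
  | inl x => exact mem_inter
  | inr u => simp [IsUp]

/-- With all vertical edges open except the one below `x`, a row point is open iff it is not `x`.
[folklore] -/
theorem isUp_erase_univ (x : S) (a : RowPoint S) : IsUp (univ.erase x) a ↔ a ≠ Sum.inl x := by
  cases a with
  | inl y => simp [IsUp, mem_erase]
  | inr u => simp [IsUp]

/-- The vertical layer only removes connections: `vertRel O π ≤ π`. [folklore] -/
theorem vertRel_le (O : Finset S) (π : Setoid (RowPoint S)) : vertRel O π ≤ π := by
  intro a b h
  rcases h with rfl | ⟨-, -, h⟩
  · exact π.refl _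
  · exact h

/-- The vertical layer is monotone in the pattern. [folklore] -/
theorem vertRel_mono (O : Finset S) {π ρ : Setoid (RowPoint S)} (h : π ≤ ρ) : vertRel O π ≤ vertRel O ρ := by
  intro a b hab
  rcases hab with rfl | ⟨ha, hb, hab⟩
  · exact Or.inl rfl
  · exact Or.inr ⟨ha, hb, h hab⟩

/-- All vertical edges open: the pattern is copied unchanged. [folklore] -/
theorem vertRel_univ (π : Setoid (RowPoint S)) : vertRel (univ : Finset S) π = π := by
  ext a b
  show vertRel univ π a b ↔ π a b
  rw [vertRel_apply]
  constructor
  · rintro (rfl | ⟨-, -, h⟩)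
    · exact π.refl _
    · exact h
  · exact fun h => Or.inr ⟨isUp_univ a, isUp_univ b, h⟩

/-- Two vertical layers compose to the vertical layer of the intersection (closed edges accumulate).
[folklore] -/
theorem vertRel_vertRel (O O' : Finset S) (π : Setoid (RowPoint S)) :
    vertRel O (vertRel O' π) = vertRel (O ∩ O') π := by
  ext a b
  show vertRel O (vertRel O' π) a b ↔ vertRel (O ∩ O') π a b
  rw [vertRel_apply, vertRel_apply, vertRel_apply, isUp_inter, isUp_inter]
  constructor
  · rintro (rfl | ⟨ha, hb, rfl | ⟨ha', hb', h⟩⟩)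
    · exact Or.inl rfl
    · exact Or.inl rfl
    · exact Or.inr ⟨⟨ha, ha'⟩, ⟨hb, hb'⟩, h⟩
  · rintro (rfl | ⟨⟨ha, ha'⟩, ⟨hb, hb'⟩, h⟩)
    · exact Or.inl rfl
    · exact Or.inr ⟨ha, hb, Or.inr ⟨ha', hb', h⟩⟩

/-- Vertical layers commute. [folklore] -/
theorem vertRel_comm (O O' : Finset S) (π : Setoid (RowPoint S)) :
    vertRel O (vertRel O' π) = vertRel O' (vertRel O π) := by
  rw [vertRel_vertRel, vertRel_vertRel, inter_comm]

/-- Vertical layers are idempotent. [folklore] -/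
theorem vertRel_idem (O : Finset S) (π : Setoid (RowPoint S)) : vertRel O (vertRel O π) = vertRel O π := by
  rw [vertRel_vertRel, inter_self]

/-- **Single closed vertical edge (`V''ᵢ` of Jacobsen–Zinn-Justin; the "detach" generator).** The
vertical edge below the new site `x` is closed and all the others are open: `x` becomes a
singleton, every other row point keeps its connections. On the frontier between the old and the
new row this is the addition of ONE closed vertical bond (Jacobsen–Zinn-Justin 2002, §4:
`T(L) = H₁⋯H_L V₁⋯V_L`, `Vᵢ = V'ᵢ + V''ᵢ`, `V'ᵢ` the identity). [cite: JacobsenZinnjustin2001, §4] -/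
def detachRel (x : S) (π : Setoid (RowPoint S)) : Setoid (RowPoint S) :=
  vertRel (univ.erase x) π

/-- Pointwise description of detaching `x`. [folklore] -/
theorem detachRel_apply (x : S) (π : Setoid (RowPoint S)) (a b : RowPoint S) :
    detachRel x π a b ↔ a = b ∨ (a ≠ Sum.inl x ∧ b ≠ Sum.inl x ∧ π a b) := by
  rw [detachRel, vertRel_apply, isUp_erase_univ, isUp_erase_univ]

/-- Closing one more vertical edge is detaching that site afterwards:
`vertRel (O.erase x) = detachRel x ∘ vertRel O`. [cite: JacobsenZinnjustin2001, §4] -/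
theorem vertRel_erase (O : Finset S) (x : S) (π : Setoid (RowPoint S)) :
    vertRel (O.erase x) π = detachRel x (vertRel O π) := by
  rw [detachRel, vertRel_vertRel, erase_inter, univ_inter]

/-- Detaching is idempotent (`e² = e` at loop weight `1`). [cite: PearceRittenbergDeGierNienhuis2002, §2 (TL)] -/
theorem detachRel_detachRel (x : S) (π : Setoid (RowPoint S)) :
    detachRel x (detachRel x π) = detachRel x π :=
  vertRel_idem _ π

/-- Detach generators commute. [cite: PearceRittenbergDeGierNienhuis2002, §2 (TL)] -/
theorem detachRel_comm (x y : S) (π : Setoid (RowPoint S)) :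
    detachRel x (detachRel y π) = detachRel y (detachRel x π) :=
  vertRel_comm _ _ π

/-! ### Horizontal layer: no edge, unions, single open edge -/

/-- Pointwise description of `joinTwo`: the kernel of the map collapsing `v` onto `u`. [folklore] -/
theorem joinTwo_apply (u v a b : RowPoint S) :
    joinTwo u v a b ↔ (if a = v then u else a) = (if b = v then u else b) :=
  Iff.rfl

/-- `joinTwo u v` joins `u` and `v`. [folklore] -/
theorem joinTwo_rel (u v : RowPoint S) : joinTwo u v u v := by
  rw [joinTwo_apply, ite_self, if_pos rfl]

/-- `joinTwo u v` is below a partition iff that partition joins `u` and `v`. [folklore] -/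
theorem joinTwo_le_iff (u v : RowPoint S) (ρ : Setoid (RowPoint S)) : joinTwo u v ≤ ρ ↔ ρ u v := by
  constructor
  · exact fun h => h (joinTwo_rel u v)
  · intro h a b hab
    rw [joinTwo_apply] at hab
    split_ifs at hab with ha hb hb
    · subst ha; subst hb; exact ρ.refl _
    · subst ha; subst hab; exact ρ.symm h
    · subst hb; subst hab; exact h
    · subst hab; exact ρ.refl _

/-- **Merging two classes, pointwise.** After joining `u` and `v`, two points are connected iff
they were, or each of them was connected to `u` or to `v`. [folklore] -/
theorem sup_joinTwo_apply (π : Setoid (RowPoint S)) (u v a b : RowPoint S) :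
    (π ⊔ joinTwo u v) a b ↔ π a b ∨ ((π a u ∨ π a v) ∧ (π b u ∨ π b v)) := by
  -- the right-hand side is an equivalence relation `ρ`
  let ρ : Setoid (RowPoint S) :=
    { r := fun a b => π a b ∨ ((π a u ∨ π a v) ∧ (π b u ∨ π b v))
      iseqv :=
        { refl := fun a => Or.inl (π.refl a)
          symm := by
            rintro a b (h | ⟨ha, hb⟩)
            · exact Or.inl (π.symm h)
            · exact Or.inr ⟨hb, ha⟩
          trans := by
            rintro a b c (h₁ | ⟨ha, hb⟩) (h₂ | ⟨hb', hc⟩)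
            · exact Or.inl (π.trans h₁ h₂)
            · refine Or.inr ⟨?_, hc⟩
              exact hb'.imp (π.trans h₁) (π.trans h₁)
            · refine Or.inr ⟨ha, ?_⟩
              exact hb.imp (π.trans (π.symm h₂)) (π.trans (π.symm h₂))
            · exact Or.inr ⟨ha, hc⟩ } }
  change (π ⊔ joinTwo u v) a b ↔ ρ a b
  suffices h : π ⊔ joinTwo u v = ρ by rw [h]
  apply le_antisymm
  · refine sup_le (fun a b h => Or.inl h) ?_
    rw [joinTwo_le_iff]
    exact Or.inr ⟨Or.inl (π.refl u), Or.inr (π.refl v)⟩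
  · rintro a b (h | ⟨ha, hb⟩)
    · exact (le_sup_left : π ≤ π ⊔ joinTwo u v) h
    · have hπ : π ≤ π ⊔ joinTwo u v := le_sup_left
      have huv : (π ⊔ joinTwo u v) u v := (le_sup_right : joinTwo u v ≤ _) (joinTwo_rel u v)
      -- `a ~ u or v`, `u ~ v`, `u or v ~ b`
      have hau : (π ⊔ joinTwo u v) a u := by
        rcases ha with ha | ha
        · exact hπ ha
        · exact Setoid.trans' _ (hπ ha) (Setoid.symm' _ huv)
      have hub : (π ⊔ joinTwo u v) u b := by
        rcases hb with hb | hb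
        · exact Setoid.symm' _ (hπ hb)
        · exact Setoid.trans' _ huv (Setoid.symm' _ (hπ hb))
      exact Setoid.trans' _ hau hub

/-- Membership in `hEdges S`: `x` labels a horizontal edge iff `x + 1` is a column. [folklore] -/
@[simp] theorem mem_hEdges (x : S) : x ∈ hEdges S ↔ (x : ℤ) + 1 ∈ S := by
  simp [hEdges]

/-- The edge relation at `x` when `x + 1` is not a column: trivial. [folklore] -/
theorem hEdgeRel_of_not_mem (x : S) (h : (x : ℤ) + 1 ∉ S) : hEdgeRel x = ⊥ :=
  dif_neg h

/-- The edge relation at `x` when `x + 1 ∈ S`: join `x` and `x + 1`. [folklore] -/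
theorem hEdgeRel_of_mem (x : S) (h : (x : ℤ) + 1 ∈ S) :
    hEdgeRel x = joinTwo (Sum.inl x) (Sum.inl ⟨(x : ℤ) + 1, h⟩) :=
  dif_pos h

/-- **Single open horizontal edge (`Hᵢ` of Jacobsen–Zinn-Justin; the "join" generator).** Open the
edge `{x, x + 1}` inside the row: merge the classes of `x` and `x + 1` (nothing happens when
`x + 1` is not a column). [cite: JacobsenZinnjustin2001, §4] -/
def joinRel (x : S) (π : Setoid (RowPoint S)) : Setoid (RowPoint S) :=
  π ⊔ hEdgeRel x

/-- No horizontal edge open: the pattern is unchanged. [folklore] -/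
theorem horizRel_empty (π : Setoid (RowPoint S)) : horizRel (∅ : Finset S) π = π := by
  rw [horizRel, Finset.sup_empty]
  exact sup_bot_eq π

/-- Opening two sets of horizontal edges one after the other. [folklore] -/
theorem horizRel_union (H H' : Finset S) (π : Setoid (RowPoint S)) :
    horizRel (H ∪ H') π = horizRel H (horizRel H' π) := by
  rw [horizRel, horizRel, horizRel, Finset.sup_union, sup_assoc, _root_.sup_comm (H'.sup hEdgeRel)]

/-- A single open horizontal edge is the join generator. [folklore] -/
theorem horizRel_singleton (x : S) (π : Setoid (RowPoint S)) : horizRel {x} π = joinRel x π := by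
  rw [horizRel, Finset.sup_singleton]
  rfl

/-- Opening one more horizontal edge is joining afterwards:
`horizRel (insert x H) = joinRel x ∘ horizRel H`. [cite: JacobsenZinnjustin2001, §4] -/
theorem horizRel_insert (x : S) (H : Finset S) (π : Setoid (RowPoint S)) :
    horizRel (insert x H) π = joinRel x (horizRel H π) := by
  rw [insert_eq, horizRel_union, horizRel_singleton]

/-- Opening an edge only adds connections: `π ≤ joinRel x π`. [folklore] -/
theorem le_joinRel (x : S) (π : Setoid (RowPoint S)) : π ≤ joinRel x π :=
  le_sup_left

/-- Joining is idempotent (`e² = e` at loop weight `1`). [cite: PearceRittenbergDeGierNienhuis2002, §2 (TL)] -/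
theorem joinRel_joinRel (x : S) (π : Setoid (RowPoint S)) : joinRel x (joinRel x π) = joinRel x π := by
  rw [joinRel, joinRel, sup_assoc, _root_.sup_idem]

/-- Join generators commute. [cite: PearceRittenbergDeGierNienhuis2002, §2 (TL)] -/
theorem joinRel_comm (x y : S) (π : Setoid (RowPoint S)) :
    joinRel x (joinRel y π) = joinRel y (joinRel x π) := by
  rw [joinRel, joinRel, joinRel, joinRel, sup_right_comm]

/-- When `x + 1` is not a column the join generator at `x` is the identity. [folklore] -/
theorem joinRel_of_not_mem (x : S) (h : (x : ℤ) + 1 ∉ S) (π : Setoid (RowPoint S)) : joinRel x π = π := by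
  rw [joinRel, hEdgeRel_of_not_mem x h]
  exact sup_bot_eq π

/-- Pointwise description of the join generator (`x + 1 ∈ S`). [folklore] -/
theorem joinRel_apply (x : S) (h : (x : ℤ) + 1 ∈ S) (π : Setoid (RowPoint S)) (a b : RowPoint S) :
    joinRel x π a b ↔ π a b ∨
      ((π a (Sum.inl x) ∨ π a (Sum.inl ⟨(x : ℤ) + 1, h⟩)) ∧
        (π b (Sum.inl x) ∨ π b (Sum.inl ⟨(x : ℤ) + 1, h⟩))) := by
  rw [joinRel, hEdgeRel_of_mem x h]
  exact sup_joinTwo_apply π _ _ a b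

/-- The edge relation at `x` joins `x` and `x + 1`. [folklore] -/
theorem hEdgeRel_rel (x : S) (h : (x : ℤ) + 1 ∈ S) :
    hEdgeRel x (Sum.inl x) (Sum.inl ⟨(x : ℤ) + 1, h⟩) := by
  rw [hEdgeRel_of_mem x h]
  exact joinTwo_rel _ _

/-- After opening the edge at `x`, the sites `x` and `x + 1` are joined. [folklore] -/
theorem joinRel_rel (x : S) (h : (x : ℤ) + 1 ∈ S) (π : Setoid (RowPoint S)) :
    joinRel x π (Sum.inl x) (Sum.inl ⟨(x : ℤ) + 1, h⟩) :=
  (le_sup_right : hEdgeRel x ≤ joinRel x π) (hEdgeRel_rel x h)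

/-- The two endpoints of a horizontal edge are distinct columns. [folklore] -/
theorem ne_hEdgeSucc (x : S) (h : (x : ℤ) + 1 ∈ S) : x ≠ ⟨(x : ℤ) + 1, h⟩ := by
  intro e
  have := congrArg Subtype.val e
  simp at this

/-- In a detached pattern the detached site is joined only to itself. [folklore] -/
theorem detachRel_rel_inl_iff (p : S) (π : Setoid (RowPoint S)) (a : RowPoint S) :
    detachRel p π a (Sum.inl p) ↔ a = Sum.inl p := by
  rw [detachRel_apply]
  constructor
  · rintro (h | ⟨-, h, -⟩)
    · exact h
    · exact absurd rfl h
  · exact Or.inl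

/-! ### The generators on connectivity states; peeling `rowStep` one edge at a time -/

namespace RowState

/-- **The detach generator `D_x` on connectivity states** (one closed vertical bond).
[cite: JacobsenZinnjustin2001, §4] -/
def detach (x : S) (π : RowState S) : RowState S :=
  ⟨detachRel x π.rel⟩

/-- **The join generator `J_x` on connectivity states** (one open horizontal bond).
[cite: JacobsenZinnjustin2001, §4] -/
def join (x : S) (π : RowState S) : RowState S :=
  ⟨joinRel x π.rel⟩

/-- `D_x² = D_x`. [cite: PearceRittenbergDeGierNienhuis2002, §2 (TL)] -/
@[simp] theorem detach_detach (x : S) (π : RowState S) : detach x (detach x π) = detach x π :=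
  RowState.ext (detachRel_detachRel x π.rel)

/-- `J_x² = J_x`. [cite: PearceRittenbergDeGierNienhuis2002, §2 (TL)] -/
@[simp] theorem join_join (x : S) (π : RowState S) : join x (join x π) = join x π :=
  RowState.ext (joinRel_joinRel x π.rel)

/-- Detach generators commute. [cite: PearceRittenbergDeGierNienhuis2002, §2 (TL)] -/
theorem detach_comm (x y : S) (π : RowState S) : detach x (detach y π) = detach y (detach x π) :=
  RowState.ext (detachRel_comm x y π.rel)

/-- Join generators commute. [cite: PearceRittenbergDeGierNienhuis2002, §2 (TL)] -/
theorem join_comm (x y : S) (π : RowState S) : join x (join y π) = join y (join x π) :=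
  RowState.ext (joinRel_comm x y π.rel)

end RowState

/-- With every vertical edge open and no horizontal edge open, a row step copies the pattern. [folklore] -/
theorem rowStep_univ_empty (π : RowState S) : rowStep univ ∅ π = π := by
  apply RowState.ext
  show horizRel ∅ (vertRel univ π.rel) = π.rel
  rw [horizRel_empty, vertRel_univ]

/-- A row step is its vertical layer followed by its horizontal layer. [cite: JacobsenZinnjustin2001, §4] -/
theorem rowStep_eq_horiz_vert (O H : Finset S) (π : RowState S) :
    rowStep O H π = rowStep univ H (rowStep O ∅ π) := by
  apply RowState.ext
  show horizRel H (vertRel O π.rel) = horizRel H (vertRel univ (horizRel ∅ (vertRel O π.rel)))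
  rw [vertRel_univ, horizRel_empty]

/-- **Peeling one vertical bond**: closing the vertical edge below `x` is applying `D_x` after the
vertical layer. [cite: JacobsenZinnjustin2001, §4] -/
theorem rowStep_erase_empty (O : Finset S) (x : S) (π : RowState S) :
    rowStep (O.erase x) ∅ π = RowState.detach x (rowStep O ∅ π) := by
  apply RowState.ext
  show horizRel ∅ (vertRel (O.erase x) π.rel) = detachRel x (horizRel ∅ (vertRel O π.rel))
  rw [horizRel_empty, horizRel_empty, vertRel_erase]

/-- **Peeling one horizontal bond**: opening the edge at `x` is applying `J_x` after the step.
[cite: JacobsenZinnjustin2001, §4] -/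
theorem rowStep_insert (O H : Finset S) (x : S) (π : RowState S) :
    rowStep O (insert x H) π = RowState.join x (rowStep O H π) := by
  apply RowState.ext
  show horizRel (insert x H) (vertRel O π.rel) = joinRel x (horizRel H (vertRel O π.rel))
  rw [horizRel_insert]

/-! ### The single-bond transfer factors at `p = 1/2` -/

/-- **The transfer factor of one vertical bond at `p = 1/2`**, `V_x = (1 + D_x)/2`, acting on
(signed) distributions over connectivity states: with probability `1/2` the bond is open (identity),
with probability `1/2` it is closed (push forward along `D_x`). [cite: JacobsenZinnjustin2001, §4] -/
def vertFactor (x : S) : Module.End ℝ (RowState S → ℝ) :=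
  (2 : ℝ)⁻¹ • (1 + statePushforward (RowState.detach x))

/-- **The transfer factor of one horizontal bond at `p = 1/2`**, `H_x = (1 + J_x)/2`: with
probability `1/2` the bond is closed (identity), with probability `1/2` it is open (push forward
along `J_x`). [cite: JacobsenZinnjustin2001, §4] -/
def horizFactor (x : S) : Module.End ℝ (RowState S → ℝ) :=
  (2 : ℝ)⁻¹ • (1 + statePushforward (RowState.join x))

end Literature.Probability.LatticeModels

end
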